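import Mathlib.Analysis.Calculus.ContDiff.FiniteDimension
import Mathlib.Analysis.Calculus.ContDiff.Bounds
import Mathlib.Analysis.InnerProductSpace.PiL2
import Mathlib.Analysis.InnerProductSpace.Calculus
import Mathlib.Analysis.SpecialFunctions.Integrals.Basic
import Mathlib.MeasureTheory.Integral.IntervalIntegral.Basic
import Mathlib.MeasureTheory.Function.StronglyMeasurable.Basic
import HarnessLib

/-!
# Tools for the difference-quotient bootstrap of bounded mild solutions (KNSS 2009, §4)

Analysis/FluidPDE support file (everything proved; no definitions, no named facts) on the
discharge path of `Literature.Analysis.FluidPDE.KNSS2009_mild_regularity`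
(`KNSSRegularityGalilean`; Koch–Nadirashvili–Seregin–Šverák, Acta Math. 203 (2009) =
arXiv:0709.3599v1, §4, Proposition 4.1 with (4.6) and the closing paragraph (4.8)–(4.11): all
`x`-derivatives of a bounded mild solution of Navier–Stokes are bounded on `ℝ³ × (δ, T)`). The
tree proves that fact by a **difference-quotient bootstrap** in the heat-flow realisation of the
Oseen tensor (`oseenHeat`): at level `k` one bounds the first differences
`∇ᵏV(t, · + h) − ∇ᵏV(t, ·)` of the `k`-times differentiated mild identity by a singular Gronwall
argument, then upgrades the resulting Lipschitz bound to `V(t) ∈ C^{k+1}` by dominated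
differentiation of the Duhamel integral. This file collects the generic, Navier–Stokes-free
ingredients:

* `sSup_le_two_mul_of_forall_le_add_half` — the real-number core of the sup-form singular
  Gronwall lemma (`K ≤ A + K/2 ⇒ K ≤ 2A` for a bounded set of weighted increments);
* `integral_rpow_neg_half_mul_rpow_neg_half_le` — the Beta-type bound
  `∫ₛ^σ (σ − ρ)^{-1/2} (ρ − s)^{-1/2} dρ ≤ 4` (exact value `π`; split at the midpoint), with the
  interval integrability of the product weight;
* calculus of iterated derivatives: `contDiff_succ_of_contDiff_one_iteratedFDeriv_apply`
  (a `C^k` map all of whose evaluated `k`-th derivatives `x ↦ Dᵏf(x)·m` are `C¹` is `C^{k+1}`,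
  finite-dimensional source; for `D^{k+1}f(x)(v, m) = ∂ᵥ(Dᵏf·m)(x)` use Mathlib's
  `DifferentiableAt.iteratedFDeriv_succ_apply_left'`), the mean-value bound
  `norm_iteratedFDeriv_add_sub_le` for first differences of `Dʲf`, sup bounds for products
  (`norm_iteratedFDeriv_mul_le_of_bounds`) and for frame components of vector fields;
* `aestronglyMeasurable_fderiv_of_forall_apply` — measurability in a parameter `σ` of
  `σ ↦ D(g σ)(x₀)` from measurability of every point evaluation `σ ↦ g σ x`, for differentiable
  slices (the derivative is a pointwise limit of difference quotients; the `CLM` is assembled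
  from its values on an orthonormal frame). This is what keeps the bootstrap free of any joint
  continuity in `(t, x)`.

## Mathlib / tree search

Mathlib: `contDiff_succ_iff_fderiv_apply`, `contDiff_clm_apply_iff`,
`iteratedFDeriv_succ_apply_right/left`, `DifferentiableAt.iteratedFDeriv_succ_apply_left'`,
`iteratedFDeriv_clm_apply_const_apply`,
`norm_iteratedFDeriv_mul_le`, `ContinuousLinearMap.norm_iteratedFDeriv_comp_left`,
`norm_iteratedFDeriv_fderiv`, `Convex.norm_image_sub_le_of_norm_fderiv_le`,
`norm_fderiv_le_of_lipschitz`, `HasFDerivAt.lim`, `aestronglyMeasurable_of_tendsto_ae`,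
`OrthonormalBasis.sum_repr'`, `ContinuousLinearMap.smulRightL`, `integral_rpow`,
`intervalIntegral.intervalIntegrable_rpow'`. Tree: `intervalIntegrable_rpow_neg_half_sub`,
`integral_rpow_neg_half_sub_eq` (`OseenDuhamelMeasurable`, not imported here to keep this file
Mathlib-only); no sup-form singular Gronwall (`lean search 'ronwall' --decl`: integral forms only).

## References

* G. Koch, N. Nadirashvili, G. Seregin, V. Šverák, *Liouville theorems for the Navier–Stokes
  equations and applications*, Acta Math. 203 (2009) 83–105 = arXiv:0709.3599v1, §4,
  Prop. 4.1, (4.5)–(4.6): "The key is an estimate of `B` … in spaces with norms given by the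
  left-hand side of (4.5)". [KochNadirashviliSereginSverak2009]
* Y. Giga, K. Inui, S. Matsui, *On the Cauchy problem for the Navier–Stokes equations with
  nondecaying initial data*, Quad. Mat. 4 (1999) 27–68, §3 (difference quotients and the
  singular Gronwall inequality for `L^∞` mild solutions).
-/

noncomputable section

open MeasureTheory Set Function Filter TopologicalSpace InnerProductSpace Metric
open scoped Topology NNReal ENNReal

namespace Literature.Analysis.FluidPDE

/-! All declarations of the difference-quotient bootstrap live in the sub-namespace
`Literature.Analysis.FluidPDE.KNSSBootstrap` (it names the method of KNSS 2009, §4 / Prop. 4.1 as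
run in the tree, and keeps these generic helper names out of the crowded `FluidPDE` namespace). -/
namespace KNSSBootstrap

/-! ### The sup-form singular Gronwall core and the Beta weight -/

section Gronwall

/-- **Sup-form Gronwall core**: if every element of a nonempty bounded set of reals is at most
`A + (sup of the set)/2`, then the sup is at most `2A`. (Applied to the set of weighted increments
`(σ − s)^{1/2} ‖∇ᵏV(σ, x + h) − ∇ᵏV(σ, x)‖`, this is the singular Gronwall lemma of the `L^∞`
theory of mild solutions, with the integral inequality already evaluated.) [folklore] -/
theorem sSup_le_two_mul_of_forall_le_add_half {S : Set ℝ} (hne : S.Nonempty)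
    {A : ℝ} (h : ∀ a ∈ S, a ≤ A + sSup S / 2) : sSup S ≤ 2 * A := by
  have h1 : sSup S ≤ A + sSup S / 2 := csSup_le hne h
  linarith

/-- Every element of such a set is then at most `2A`. [folklore] -/
theorem le_two_mul_of_forall_le_add_half {S : Set ℝ} (hbdd : BddAbove S)
    {A : ℝ} (h : ∀ a ∈ S, a ≤ A + sSup S / 2) {a : ℝ} (ha : a ∈ S) : a ≤ 2 * A :=
  (le_csSup hbdd ha).trans (sSup_le_two_mul_of_forall_le_add_half ⟨a, ha⟩ h)

/-- `ρ ↦ (ρ − s)^{-1/2}` is interval integrable on every interval. [folklore] -/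
theorem intervalIntegrable_rpow_neg_half_sub_left (a b s : ℝ) :
    IntervalIntegrable (fun ρ : ℝ => (ρ - s) ^ (-(1 / 2 : ℝ))) volume a b := by
  have h := (intervalIntegral.intervalIntegrable_rpow' (a := a - s) (b := b - s)
    (by norm_num : (-1 : ℝ) < -(1 / 2))).comp_sub_right s
  simpa using h

/-- `ρ ↦ (σ − ρ)^{-1/2}` is interval integrable on every interval. [folklore] -/
theorem intervalIntegrable_rpow_neg_half_sub_right (a b σ : ℝ) :
    IntervalIntegrable (fun ρ : ℝ => (σ - ρ) ^ (-(1 / 2 : ℝ))) volume a b := by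
  have h := (intervalIntegral.intervalIntegrable_rpow' (a := σ - a) (b := σ - b)
    (by norm_num : (-1 : ℝ) < -(1 / 2))).comp_sub_left σ
  simpa using h

/-- `∫ₐᵇ (ρ − s)^{-1/2} dρ = 2((b − s)^{1/2} − (a − s)^{1/2})`. [folklore] -/
theorem integral_rpow_neg_half_sub_left (s a b : ℝ) :
    ∫ ρ in a..b, (ρ - s) ^ (-(1 / 2 : ℝ)) = 2 * ((b - s) ^ (1 / 2 : ℝ) - (a - s) ^ (1 / 2 : ℝ)) := by
  rw [intervalIntegral.integral_comp_sub_right (fun ρ => ρ ^ (-(1 / 2 : ℝ))) s,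
    integral_rpow (Or.inl (by norm_num : (-1 : ℝ) < -(1 / 2)))]
  rw [show (-(1 / 2 : ℝ)) + 1 = 1 / 2 by norm_num]
  field_simp

/-- `∫ₐᵇ (σ − ρ)^{-1/2} dρ = 2((σ − a)^{1/2} − (σ − b)^{1/2})`. [folklore] -/
theorem integral_rpow_neg_half_sub_right (σ a b : ℝ) :
    ∫ ρ in a..b, (σ - ρ) ^ (-(1 / 2 : ℝ)) = 2 * ((σ - a) ^ (1 / 2 : ℝ) - (σ - b) ^ (1 / 2 : ℝ)) := by
  rw [intervalIntegral.integral_comp_sub_left (fun ρ => ρ ^ (-(1 / 2 : ℝ))) σ,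
    integral_rpow (Or.inl (by norm_num : (-1 : ℝ) < -(1 / 2)))]
  rw [show (-(1 / 2 : ℝ)) + 1 = 1 / 2 by norm_num]
  field_simp

/-- `x^{-1/2} · x^{1/2} = 1` for `x > 0`. [folklore] -/
theorem rpow_neg_half_mul_rpow_half {x : ℝ} (hx : 0 < x) :
    x ^ (-(1 / 2 : ℝ)) * x ^ (1 / 2 : ℝ) = 1 := by
  rw [Real.rpow_neg hx.le, inv_mul_cancel₀ (Real.rpow_pos_of_pos hx _).ne']

/-- **The product weight is interval integrable**: `ρ ↦ (σ − ρ)^{-1/2} (ρ − s)^{-1/2}` on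
`[s, σ]` (each factor is singular at one endpoint only; split at the midpoint). [folklore] -/
theorem intervalIntegrable_rpow_neg_half_mul {s σ : ℝ} (hsσ : s < σ) :
    IntervalIntegrable (fun ρ : ℝ => (σ - ρ) ^ (-(1 / 2 : ℝ)) * (ρ - s) ^ (-(1 / 2 : ℝ)))
      volume s σ := by
  set c : ℝ := (s + σ) / 2 with hc
  have hsc : s < c := by rw [hc]; linarith
  have hcσ : c < σ := by rw [hc]; linarith
  -- on `[s, c]` the first factor is continuous
  have h1 : IntervalIntegrable (fun ρ : ℝ => (σ - ρ) ^ (-(1 / 2 : ℝ)) * (ρ - s) ^ (-(1 / 2 : ℝ)))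
      volume s c := by
    have hcont : ContinuousOn (fun ρ : ℝ => (σ - ρ) ^ (-(1 / 2 : ℝ))) (uIcc s c) := by
      rw [uIcc_of_le hsc.le]
      exact ContinuousOn.rpow_const (continuousOn_const.sub continuousOn_id) fun ρ hρ =>
        Or.inl (by linarith [hρ.2] : σ - ρ ≠ 0)
    exact (intervalIntegrable_rpow_neg_half_sub_left s c s).continuousOn_mul hcont
  -- on `[c, σ]` the second factor is continuous
  have h2 : IntervalIntegrable (fun ρ : ℝ => (σ - ρ) ^ (-(1 / 2 : ℝ)) * (ρ - s) ^ (-(1 / 2 : ℝ)))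
      volume c σ := by
    have hcont : ContinuousOn (fun ρ : ℝ => (ρ - s) ^ (-(1 / 2 : ℝ))) (uIcc c σ) := by
      rw [uIcc_of_le hcσ.le]
      exact ContinuousOn.rpow_const (continuousOn_id.sub continuousOn_const) fun ρ hρ =>
        Or.inl (by linarith [hρ.1] : ρ - s ≠ 0)
    exact (intervalIntegrable_rpow_neg_half_sub_right c σ σ).mul_continuousOn hcont
  exact h1.trans h2

/-- **Beta-type bound**: `∫ₛ^σ (σ − ρ)^{-1/2} (ρ − s)^{-1/2} dρ ≤ 4` for `s < σ` (the exact value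
is `B(1/2, 1/2) = π`; on each half of `[s, σ]` the factor which is not singular there is at most
`((σ − s)/2)^{-1/2}`, and the singular one integrates to `2((σ − s)/2)^{1/2}`). [folklore] -/
theorem integral_rpow_neg_half_mul_rpow_neg_half_le {s σ : ℝ} (hsσ : s < σ) :
    ∫ ρ in s..σ, (σ - ρ) ^ (-(1 / 2 : ℝ)) * (ρ - s) ^ (-(1 / 2 : ℝ)) ≤ 4 := by
  set c : ℝ := (s + σ) / 2 with hc
  have hsc : s < c := by rw [hc]; linarith
  have hcσ : c < σ := by rw [hc]; linarith
  have hd : 0 < (σ - s) / 2 := by linarith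
  have hcs : c - s = (σ - s) / 2 := by rw [hc]; ring
  have hσc : σ - c = (σ - s) / 2 := by rw [hc]; ring
  set w : ℝ := ((σ - s) / 2) ^ (-(1 / 2 : ℝ)) with hw
  have hw0 : 0 ≤ w := Real.rpow_nonneg hd.le _
  have hprod := intervalIntegrable_rpow_neg_half_mul hsσ
  have hsub1 : uIcc s c ⊆ uIcc s σ := by
    rw [uIcc_of_le hsc.le, uIcc_of_le hsσ.le]; exact Icc_subset_Icc_right hcσ.le
  have hsub2 : uIcc c σ ⊆ uIcc s σ := by
    rw [uIcc_of_le hcσ.le, uIcc_of_le hsσ.le]; exact Icc_subset_Icc_left hsc.le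
  -- first half
  have hI1 : ∫ ρ in s..c, (σ - ρ) ^ (-(1 / 2 : ℝ)) * (ρ - s) ^ (-(1 / 2 : ℝ)) ≤ 2 := by
    have hle : ∫ ρ in s..c, (σ - ρ) ^ (-(1 / 2 : ℝ)) * (ρ - s) ^ (-(1 / 2 : ℝ)) ≤
        ∫ ρ in s..c, w * (ρ - s) ^ (-(1 / 2 : ℝ)) := by
      refine intervalIntegral.integral_mono_on_of_le_Ioo hsc.le (hprod.mono_set hsub1)
        ((intervalIntegrable_rpow_neg_half_sub_left s c s).const_mul w) fun ρ hρ => ?_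
      have hρs : 0 < ρ - s := sub_pos.2 hρ.1
      refine mul_le_mul_of_nonneg_right ?_ (Real.rpow_nonneg hρs.le _)
      exact Real.rpow_le_rpow_of_nonpos hd (by linarith [hρ.2]) (by norm_num)
    refine hle.trans ?_
    rw [intervalIntegral.integral_const_mul, integral_rpow_neg_half_sub_left s s c, sub_self,
      Real.zero_rpow (by norm_num : (1 / 2 : ℝ) ≠ 0), sub_zero, hcs, hw]
    rw [show ((σ - s) / 2) ^ (-(1 / 2 : ℝ)) * (2 * ((σ - s) / 2) ^ (1 / 2 : ℝ)) =
      2 * (((σ - s) / 2) ^ (-(1 / 2 : ℝ)) * ((σ - s) / 2) ^ (1 / 2 : ℝ)) by ring,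
      rpow_neg_half_mul_rpow_half hd, mul_one]
  -- second half
  have hI2 : ∫ ρ in c..σ, (σ - ρ) ^ (-(1 / 2 : ℝ)) * (ρ - s) ^ (-(1 / 2 : ℝ)) ≤ 2 := by
    have hle : ∫ ρ in c..σ, (σ - ρ) ^ (-(1 / 2 : ℝ)) * (ρ - s) ^ (-(1 / 2 : ℝ)) ≤
        ∫ ρ in c..σ, (σ - ρ) ^ (-(1 / 2 : ℝ)) * w := by
      refine intervalIntegral.integral_mono_on_of_le_Ioo hcσ.le (hprod.mono_set hsub2)
        ((intervalIntegrable_rpow_neg_half_sub_right c σ σ).mul_const w) fun ρ hρ => ?_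
      have hσρ : 0 < σ - ρ := sub_pos.2 hρ.2
      refine mul_le_mul_of_nonneg_left ?_ (Real.rpow_nonneg hσρ.le _)
      exact Real.rpow_le_rpow_of_nonpos hd (by linarith [hρ.1]) (by norm_num)
    refine hle.trans ?_
    rw [intervalIntegral.integral_mul_const, integral_rpow_neg_half_sub_right σ c σ, sub_self,
      Real.zero_rpow (by norm_num : (1 / 2 : ℝ) ≠ 0), sub_zero, hσc, hw]
    rw [show 2 * ((σ - s) / 2) ^ (1 / 2 : ℝ) * ((σ - s) / 2) ^ (-(1 / 2 : ℝ)) =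
      2 * (((σ - s) / 2) ^ (-(1 / 2 : ℝ)) * ((σ - s) / 2) ^ (1 / 2 : ℝ)) by ring,
      rpow_neg_half_mul_rpow_half hd, mul_one]
  rw [← intervalIntegral.integral_add_adjacent_intervals (hprod.mono_set hsub1)
    (hprod.mono_set hsub2)]
  linarith

end Gronwall

/-! ### Calculus of evaluated iterated derivatives -/

section Calculus

variable {E : Type*} [NormedAddCommGroup E] [NormedSpace ℝ E]
variable {F : Type*} [NormedAddCommGroup F] [NormedSpace ℝ F]

/-- Evaluated `k`-th derivatives of the derivative: for `f ∈ C^{k+1}`,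
`Dᵏ(y ↦ Df(y)·w)(x)·m = D^{k+1}f(x)(m, w)` (`iteratedFDeriv_succ_apply_right` read through
`iteratedFDeriv_clm_apply_const_apply`). [folklore] -/
theorem iteratedFDeriv_fderiv_apply_eq_snoc {f : E → F} {k : ℕ}
    (hf : ContDiff ℝ (k + 1) f) (x : E) (w : E) (m : Fin k → E) :
    iteratedFDeriv ℝ k (fun y => fderiv ℝ f y w) x m = iteratedFDeriv ℝ (k + 1) f x (Fin.snoc m w) := by
  have hc : ContDiff ℝ k (fderiv ℝ f) := hf.fderiv_right le_rfl
  rw [iteratedFDeriv_clm_apply_const_apply hc le_rfl, iteratedFDeriv_succ_apply_right,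
    Fin.init_snoc, Fin.snoc_last]

variable [FiniteDimensional ℝ E]

/-- **A `C^k` map whose evaluated `k`-th derivatives are all `C¹` is `C^{k+1}`** (finite-dimensional
source): if `f ∈ C^k` and `x ↦ Dᵏf(x)(m)` is `C¹` for every `m`, then `f ∈ C^{k+1}`. (Induction on
`k` through `contDiff_succ_iff_fderiv_apply`: `f ∈ C^{k+2}` iff `f` is differentiable and every
`∂_w f` is `C^{k+1}`, and `Dᵏ(∂_w f)·m = D^{k+1}f·(m, w)`.) This converts the output of dominated
differentiation of the Duhamel integral (which is about the scalar-like maps `x ↦ DᵏV(t,x)·m`)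
into smoothness of the slice. [folklore] -/
theorem contDiff_succ_of_contDiff_one_iteratedFDeriv_apply :
    ∀ (k : ℕ) {f : E → F}, ContDiff ℝ k f →
      (∀ m : Fin k → E, ContDiff ℝ 1 (fun x => iteratedFDeriv ℝ k f x m)) →
      ContDiff ℝ (k + 1) f := by
  intro k
  induction k with
  | zero =>
    intro f _ h
    have h0 := h (Fin.elim0 : Fin 0 → E)
    simp only [iteratedFDeriv_zero_apply] at h0
    simpa using h0
  | succ k ih =>
    intro f hf h
    rw [show ((k + 1 : ℕ) : WithTop ℕ∞) + 1 = ((k : WithTop ℕ∞) + 1) + 1 by push_cast; ring]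
    rw [contDiff_succ_iff_fderiv_apply]
    have hf' : ContDiff ℝ ((k : WithTop ℕ∞) + 1) f := by exact_mod_cast hf
    refine ⟨hf'.differentiable (by simp), fun hω => ?_, fun w => ?_⟩
    · exact absurd hω (by exact_mod_cast (WithTop.coe_ne_top : ((k + 1 : ℕ∞) : WithTop ℕ∞) ≠ ⊤))
    · -- apply the induction hypothesis to `∂_w f`
      have hg : ContDiff ℝ k (fun y => fderiv ℝ f y w) :=
        ((contDiff_succ_iff_fderiv_apply.1 hf').2.2 w)
      refine ih hg fun m => ?_
      have hfun : (fun x => iteratedFDeriv ℝ k (fun y => fderiv ℝ f y w) x m) =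
          fun x => iteratedFDeriv ℝ (k + 1) f x (Fin.snoc m w) :=
        funext fun x => iteratedFDeriv_fderiv_apply_eq_snoc hf' x w m
      rw [hfun]
      exact h (Fin.snoc m w)

omit [FiniteDimensional ℝ E] in
/-- **Mean-value bound for first differences of iterated derivatives**: if `f ∈ C^{j+1}` with
`‖D^{j+1}f‖ ≤ C` everywhere, then `‖Dʲf(x + h) − Dʲf(x)‖ ≤ C ‖h‖`. [folklore] -/
theorem norm_iteratedFDeriv_add_sub_le {f : E → F} {j : ℕ} (hf : ContDiff ℝ (j + 1) f) {C : ℝ}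
    (hC : ∀ y, ‖iteratedFDeriv ℝ (j + 1) f y‖ ≤ C) (x h : E) :
    ‖iteratedFDeriv ℝ j f (x + h) - iteratedFDeriv ℝ j f x‖ ≤ C * ‖h‖ := by
  have hd : Differentiable ℝ (iteratedFDeriv ℝ j f) :=
    hf.differentiable_iteratedFDeriv (by exact_mod_cast Nat.lt_succ_self j)
  have hb : ∀ y ∈ (univ : Set E), ‖fderiv ℝ (iteratedFDeriv ℝ j f) y‖ ≤ C := fun y _ => by
    rw [norm_fderiv_iteratedFDeriv]
    exact hC y
  have h := (convex_univ (𝕜 := ℝ) (E := E)).norm_image_sub_le_of_norm_fderiv_le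
    (f := iteratedFDeriv ℝ j f) (fun y _ => hd y) hb (mem_univ x) (mem_univ (x + h))
  simpa using h

omit [FiniteDimensional ℝ E] in
/-- A Lipschitz bound on `Dʲf` bounds `D^{j+1}f`: if `Dʲf` is differentiable and
`‖Dʲf(x + h) − Dʲf(x)‖ ≤ L‖h‖` for all `x, h`, then `‖D^{j+1}f(x)‖ ≤ L`. [folklore] -/
theorem norm_iteratedFDeriv_succ_le_of_lipschitz {f : E → F} {j : ℕ} {L : ℝ} (hL : 0 ≤ L)
    (hlip : ∀ x h, ‖iteratedFDeriv ℝ j f (x + h) - iteratedFDeriv ℝ j f x‖ ≤ L * ‖h‖) (x : E) :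
    ‖iteratedFDeriv ℝ (j + 1) f x‖ ≤ L := by
  rw [← norm_fderiv_iteratedFDeriv]
  have hlw : LipschitzWith ⟨L, hL⟩ (iteratedFDeriv ℝ j f) := by
    refine LipschitzWith.of_dist_le_mul fun y z => ?_
    rw [dist_eq_norm, dist_eq_norm]
    have h := hlip z (y - z)
    rw [add_sub_cancel] at h
    exact h
  exact norm_fderiv_le_of_lipschitz ℝ hlw

/-- `∑_{i ≤ n} C(n, i) = 2ⁿ` in `ℝ`. [folklore] -/
theorem sum_range_choose_cast (n : ℕ) :
    ∑ i ∈ Finset.range (n + 1), (n.choose i : ℝ) = 2 ^ n := by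
  have h := Nat.sum_range_choose n
  exact_mod_cast h

omit [FiniteDimensional ℝ E] in
/-- **Sup bound for iterated derivatives of a product** of two `C^N` scalar functions: if
`‖Dⁱf‖ ≤ a` and `‖Dⁱg‖ ≤ b` for all `i ≤ n`, then `‖Dⁿ(fg)(x)‖ ≤ 2ⁿ a b`
(`norm_iteratedFDeriv_mul_le` and `∑ᵢ C(n,i) = 2ⁿ`). [folklore] -/
theorem norm_iteratedFDeriv_mul_le_of_bounds {f g : E → ℝ} {N : WithTop ℕ∞} (hf : ContDiff ℝ N f)
    (hg : ContDiff ℝ N g) {n : ℕ} (hn : (n : WithTop ℕ∞) ≤ N) {a b : ℝ} (ha : 0 ≤ a)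
    (hfa : ∀ i ≤ n, ∀ y, ‖iteratedFDeriv ℝ i f y‖ ≤ a) (hgb : ∀ i ≤ n, ∀ y, ‖iteratedFDeriv ℝ i g y‖ ≤ b)
    (x : E) :
    ‖iteratedFDeriv ℝ n (fun y => f y * g y) x‖ ≤ 2 ^ n * a * b := by
  refine (norm_iteratedFDeriv_mul_le hf hg x hn).trans ?_
  calc ∑ i ∈ Finset.range (n + 1), (n.choose i : ℝ) * ‖iteratedFDeriv ℝ i f x‖ *
        ‖iteratedFDeriv ℝ (n - i) g x‖
      ≤ ∑ i ∈ Finset.range (n + 1), (n.choose i : ℝ) * a * b := by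
        refine Finset.sum_le_sum fun i hi => ?_
        have hi' : i ≤ n := Nat.lt_succ_iff.1 (Finset.mem_range.1 hi)
        have h0 : (0 : ℝ) ≤ n.choose i := Nat.cast_nonneg _
        exact mul_le_mul (mul_le_mul_of_nonneg_left (hfa i hi' x) h0) (hgb (n - i) (Nat.sub_le n i) x)
          (norm_nonneg _) (by positivity)
    _ = 2 ^ n * a * b := by
        rw [← Finset.sum_mul, ← Finset.sum_mul, sum_range_choose_cast n]

omit [FiniteDimensional ℝ E] in
/-- **Sup bound for iterated derivatives of a product, top order separated**: if `‖Dⁱf‖ ≤ a` for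
`i < n`, `‖Dⁿf‖ ≤ q`, and `‖Dⁱg‖ ≤ b` for `i ≤ n`, then `‖Dⁿ(fg)(x)‖ ≤ q b + 2ⁿ a b`. (In the
bootstrap `f` is a first difference `φ(· + h) − φ` whose derivatives of order `< n` are `O(|h|)`
by the mean value theorem while the top one is the unknown.) [folklore] -/
theorem norm_iteratedFDeriv_mul_le_of_bounds_top {f g : E → ℝ} {N : WithTop ℕ∞} (hf : ContDiff ℝ N f)
    (hg : ContDiff ℝ N g) {n : ℕ} (hn : (n : WithTop ℕ∞) ≤ N) {a b q : ℝ} (ha : 0 ≤ a) (hb : 0 ≤ b)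
    (hq : 0 ≤ q) (hfa : ∀ i < n, ∀ y, ‖iteratedFDeriv ℝ i f y‖ ≤ a)
    (hfq : ∀ y, ‖iteratedFDeriv ℝ n f y‖ ≤ q) (hgb : ∀ i ≤ n, ∀ y, ‖iteratedFDeriv ℝ i g y‖ ≤ b)
    (x : E) :
    ‖iteratedFDeriv ℝ n (fun y => f y * g y) x‖ ≤ q * b + 2 ^ n * a * b := by
  refine (norm_iteratedFDeriv_mul_le hf hg x hn).trans ?_
  rw [Finset.sum_range_succ]
  have htop : (n.choose n : ℝ) * ‖iteratedFDeriv ℝ n f x‖ * ‖iteratedFDeriv ℝ (n - n) g x‖ ≤ q * b := by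
    rw [Nat.choose_self, Nat.cast_one, one_mul, Nat.sub_self]
    exact mul_le_mul (hfq x) (hgb 0 (Nat.zero_le n) x) (norm_nonneg _) hq
  have hlow : ∑ i ∈ Finset.range n, (n.choose i : ℝ) * ‖iteratedFDeriv ℝ i f x‖ *
      ‖iteratedFDeriv ℝ (n - i) g x‖ ≤ 2 ^ n * a * b := by
    calc ∑ i ∈ Finset.range n, (n.choose i : ℝ) * ‖iteratedFDeriv ℝ i f x‖ *
          ‖iteratedFDeriv ℝ (n - i) g x‖
        ≤ ∑ i ∈ Finset.range n, (n.choose i : ℝ) * a * b := by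
          refine Finset.sum_le_sum fun i hi => ?_
          have hi' : i < n := Finset.mem_range.1 hi
          have h0 : (0 : ℝ) ≤ n.choose i := Nat.cast_nonneg _
          exact mul_le_mul (mul_le_mul_of_nonneg_left (hfa i hi' x) h0)
            (hgb (n - i) (Nat.sub_le n i) x) (norm_nonneg _) (by positivity)
      _ ≤ ∑ i ∈ Finset.range (n + 1), (n.choose i : ℝ) * a * b :=
          Finset.sum_le_sum_of_subset_of_nonneg (Finset.range_subset_range.2 (Nat.le_succ n))
            fun i _ _ => by positivity
      _ = 2 ^ n * a * b := by
          rw [← Finset.sum_mul, ← Finset.sum_mul, sum_range_choose_cast n]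
  linarith

end Calculus

/-! ### Frame components of vector fields -/

section Frame

variable {E : Type*} [NormedAddCommGroup E] [InnerProductSpace ℝ E]
variable {D : Type*} [NormedAddCommGroup D] [NormedSpace ℝ D]

/-- **Iterated derivatives of a frame component**: `Dⁿ⟪V, v⟫(x) = ⟪·, v⟫ ∘ DⁿV(x)`, i.e.
`Dⁿ(y ↦ ⟪V y, v⟫)(x)(m) = ⟪DⁿV(x)(m), v⟫`, for `V ∈ C^N`, `n ≤ N`. [folklore] -/
theorem iteratedFDeriv_inner_const_apply {V : D → E} {N : WithTop ℕ∞} (hV : ContDiff ℝ N V) (v : E)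
    {n : ℕ} (hn : (n : WithTop ℕ∞) ≤ N) (x : D) (m : Fin n → D) :
    iteratedFDeriv ℝ n (fun y => ⟪V y, v⟫_ℝ) x m = ⟪iteratedFDeriv ℝ n V x m, v⟫_ℝ := by
  have hfun : (fun y => ⟪V y, v⟫_ℝ) = fun y => (innerSL ℝ v) (V y) := by
    funext y
    rw [innerSL_apply_apply, real_inner_comm]
  rw [hfun, ← Function.comp_def (innerSL ℝ v), (innerSL ℝ v).iteratedFDeriv_comp_left hV.contDiffAt hn]
  simp only [ContinuousLinearMap.compContinuousMultilinearMap_coe, Function.comp_apply,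
    innerSL_apply_apply, real_inner_comm]

/-- Norm of the iterated derivatives of a frame component at a unit vector:
`‖Dⁿ⟪V, v⟫(x)‖ ≤ ‖DⁿV(x)‖` when `‖v‖ ≤ 1`. [folklore] -/
theorem norm_iteratedFDeriv_inner_const_le {V : D → E} {N : WithTop ℕ∞} (hV : ContDiff ℝ N V) {v : E}
    (hv : ‖v‖ ≤ 1) {n : ℕ} (hn : (n : WithTop ℕ∞) ≤ N) (x : D) :
    ‖iteratedFDeriv ℝ n (fun y => ⟪V y, v⟫_ℝ) x‖ ≤ ‖iteratedFDeriv ℝ n V x‖ := by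
  have hfun : (fun y => ⟪V y, v⟫_ℝ) = (innerSL ℝ v) ∘ V := by
    funext y
    simp only [Function.comp_apply, innerSL_apply_apply, real_inner_comm]
  rw [hfun]
  refine ((innerSL ℝ v).norm_iteratedFDeriv_comp_left hV.contDiffAt hn).trans ?_
  rw [innerSL_apply_norm]
  exact (mul_le_mul_of_nonneg_right hv (norm_nonneg _)).trans (by rw [one_mul])

/-- Iterated derivatives of the difference of frame components of two fields:
`Dⁿ(⟪V, v⟫ − ⟪W, v⟫)(x) = ⟪·, v⟫ ∘ (DⁿV(x) − DⁿW(x))`, with the norm bound at a unit vector.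
[folklore] -/
theorem norm_iteratedFDeriv_inner_sub_inner_le {V W : D → E} {N : WithTop ℕ∞} (hV : ContDiff ℝ N V)
    (hW : ContDiff ℝ N W) {v : E} (hv : ‖v‖ ≤ 1) {n : ℕ} (hn : (n : WithTop ℕ∞) ≤ N) (x : D) :
    ‖iteratedFDeriv ℝ n (fun y => ⟪V y, v⟫_ℝ - ⟪W y, v⟫_ℝ) x‖ ≤
      ‖iteratedFDeriv ℝ n V x - iteratedFDeriv ℝ n W x‖ := by
  have hfun : (fun y => ⟪V y, v⟫_ℝ - ⟪W y, v⟫_ℝ) = fun y => ⟪V y - W y, v⟫_ℝ := by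
    funext y
    rw [inner_sub_left]
  rw [hfun]
  refine (norm_iteratedFDeriv_inner_const_le (hV.sub hW) hv hn x).trans (le_of_eq ?_)
  rw [show (fun y => V y - W y) = V - W from rfl,
    iteratedFDeriv_sub_apply (hV.contDiffAt.of_le hn) (hW.contDiffAt.of_le hn)]

end Frame

/-! ### Measurability of a parametrised derivative from its point evaluations -/

section Measurability

variable {E : Type*} [NormedAddCommGroup E] [InnerProductSpace ℝ E] [FiniteDimensional ℝ E]
variable {G : Type*} [NormedAddCommGroup G] [NormedSpace ℝ G]

/-- A continuous linear map out of a finite-dimensional inner product space is the sum of its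
values on the standard orthonormal frame: `A = ∑ⱼ ⟪eⱼ, ·⟫ A eⱼ`. [folklore] -/
theorem clm_eq_sum_smulRight_frame (A : E →L[ℝ] G) :
    A = ∑ j, (innerSL ℝ (stdOrthonormalBasis ℝ E j)).smulRight (A (stdOrthonormalBasis ℝ E j)) := by
  ext w
  simp only [FunLike.coe_sum, Finset.sum_apply, ContinuousLinearMap.smulRight_apply,
    innerSL_apply_apply]
  conv_lhs => rw [← (stdOrthonormalBasis ℝ E).sum_repr' w]
  simp only [map_sum, map_smul]

/-- **Measurability of `σ ↦ D(g σ)(x₀)` from the measurability of all point evaluations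
`σ ↦ g σ x`**, for slices `g σ` differentiable at `x₀` (a.e. in `σ`): each value
`D(g σ)(x₀) eⱼ` is the pointwise limit of the measurable difference quotients
`n (g σ (x₀ + eⱼ/n) − g σ x₀)`, and the continuous linear map is assembled from its frame values.
No joint regularity of `g` in `(σ, x)` is assumed. [folklore] -/
theorem aestronglyMeasurable_fderiv_of_forall_apply {μ : Measure ℝ} {g : ℝ → E → G} {x₀ : E}
    (hmeas : ∀ x, AEStronglyMeasurable (fun σ => g σ x) μ)
    (hdiff : ∀ᵐ σ ∂μ, DifferentiableAt ℝ (g σ) x₀) :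
    AEStronglyMeasurable (fun σ => fderiv ℝ (g σ) x₀) μ := by
  set e := stdOrthonormalBasis ℝ E with he
  -- the frame values are limits of difference quotients
  have hval : ∀ j, AEStronglyMeasurable (fun σ => fderiv ℝ (g σ) x₀ (e j)) μ := by
    intro j
    refine aestronglyMeasurable_of_tendsto_ae (u := atTop)
      (f := fun (n : ℕ) σ => (n : ℝ) • (g σ (x₀ + ((n : ℝ))⁻¹ • e j) - g σ x₀)) (fun n => ?_) ?_
    · exact ((hmeas _).sub (hmeas _)).const_smul _
    · filter_upwards [hdiff] with σ hσ
      have hc : Tendsto (fun n : ℕ => ‖((n : ℝ))‖) atTop atTop := by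
        simpa using tendsto_natCast_atTop_atTop
      exact hσ.hasFDerivAt.lim (e j) hc
  have hrepr : (fun σ => fderiv ℝ (g σ) x₀) =
      fun σ => ∑ j, (innerSL ℝ (e j)).smulRight (fderiv ℝ (g σ) x₀ (e j)) :=
    funext fun σ => clm_eq_sum_smulRight_frame _
  rw [hrepr]
  refine Finset.aestronglyMeasurable_fun_sum _ fun j _ => ?_
  have hL : Continuous fun a : G => (innerSL ℝ (e j)).smulRight a :=
    (ContinuousLinearMap.smulRightL ℝ E G (innerSL ℝ (e j))).continuous
  exact hL.comp_aestronglyMeasurable (hval j)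

end Measurability

end KNSSBootstrap

end Literature.Analysis.FluidPDE

end
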